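import Summits.ResolutionOfSingularities.ResolutionOfSingularities.Theorems.PurelyInseparableDim4ResConeHeavyLoseStep
import Summits.ResolutionOfSingularities.ResolutionOfSingularities.Theorems.PurelyInseparableDim4ResConeHeavyEntryFrame
import HarnessLib
import HarnessLib.Audit.Tags

/-!
# Purely inseparable four-folds — the HEAVY LOSE STEP ON A CONSTANT-SHADE TAIL, every prime `p`, every tame shade `d < p`
# (chain dress of `heavy_lose_step`; K2(p) lane, rung-1 generic material; cell `res-dim4-pi`)

[OURS · counted 0 · cell `res-dim4-pi` · K2(p) lane holder res-dim4-p-12 g4 (K2(7) SCOPING v1 2026-08-29 08:30Z §3: «RUNG 1 — GENERIC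
BRICKS: heavy line E/K/L/assembly ∀ (p, d)»; «generic files (no `7` in a signature) are always welcome»); seat res-dim4-p-2 g6 over its
lineage's L_gen `…ResConeHeavyLoseStep` (p709039) and res-dim4-p-9 g5's E_gen / tail bookkeeping `…ResConeHeavyEntryFrame` (p709142).]
Nothing here proves TAIL(p, d, e), K2(5) beyond p708920's model statement, K2(7), the β_h line or resolution of singularities in dimension
≥ 4 / characteristic `p` — NOT proved.  AI kernel work, weaker than expert review.

`heavy_lose_step` (L_gen) is an EDGE-level law: its factorisation package (`hF hd hdiv hbj hF' hF₁ hd₁ hiso₁ hshade he he₁`), its weights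
pattern (`hhit`, `hr'`) and half of its numerology (`hn1`, `hpo`, `ho2`, `hndvd`) are facts of every constant-shade tail, exactly as
`heavy_entryFrame` is the chain dress of `entryFrame_of_transversal`.  This file is that dress, so that a rung-2 per-tail assembly consumes
the LOSE law by ONE call with chain binders (res-dim4-p-7 g5's `(p, p−1)` heavy-line assembly does the same dressing inline for its class):
* §1 **`hit_of_direction_ne_zero`** — `(direction j b) h ≠ 0 → j = h ∨ b h ≠ 0` (converse of p-7's `heavyLine_direction_ne_zero`; E_gen's
  transversality binder `hdirW` ⇒ L_gen's pattern binder `hhit`); **`tail_newborn_weight`** — on a constant-shade tail the newborn letter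
  `j k` of `c (k+1)` weighs `|r_k| + d − p`, this weight is positive, `< p`, hence prime to `p` (L_gen's `hr'`/`hndvd`);
* §2 **`tail_heavy_lose_step`** — THE HEAVY LOSE STEP ON A TAIL: along a witnessed isolated above-floor `Step0 p` chain with `x^{r₀} ∣ F₀`,
  constant shade `d < p` and `e_G ≡ 2` from `k₀`, at any `k ≥ k₀` with a letter `h` TRANSVERSAL to the step (`(direction (j k) (b k)) h ≠ 0`,
  the same binder as E_gen's `hdirW`) and a cleaning exponent `n ≤ d` with `(|r_k| + d − p) + n = p` (the newborn is supercritical for `n`),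
  an ENTRY frame at `k` (`u₁ = e_h`, left inverse, y-rows ⟂ `resVertex (c k)`, `pts ≠ ∅`, `d! < δs` for `(G_k)`, `G_k = F_k / x^{r_k}`)
  yields a RUN frame at `k+1` (`u₁′ = e_{j k}`, y′-rows ⟂ `resVertex (c (k+1))`, `pts′ ≠ ∅`, `d! < δs′`, `d·αs′ ≤ (n−1)·d!`, `0 < αs′`)
  with `βs′ ≤ βs` — `heavy_lose_step` with every tail fact discharged by `tail_factorisation` / `tail_step_factorisation` /
  `tail_weights_laws`; the only binders left are the chain, `k ≥ k₀`, the transversal letter, the exponent `n` and the entry frame;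
* §3 **`tail_heavy_lose_step_newborn`** — the same with the RUN frame's letter bookkeeping `r_{k+1} (j k) = |r_k| + d − p` and
  `r_{k+1} (j k) + n = p` appended (the next edge's supercriticality `p ≤ r_{k+1} (j k) + n`, E_gen's `hn` at `k+1`).
Instances: `(p, d, n) = (5, 4, 3)` at a `(2,1)`-state of TAIL-D is `dInf_lose_step`'s use in `…ResConeDInfTail`; `(5, 3, 3)` at a `(2,1,1)`-state
of TAIL-B is `bInf_lose_step`'s; `(p, p−1, p−2)` at a `(2,1)`-state is the L-branch of p-7 g5's `no_heavyLine_tail`.  NUMEROLOGY NOTE (rung-0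
datum, weight ledger of OUR frame): `n ≤ d` reads `2p ≤ |r_k| + 2d`, i.e. the LOSE law as typed serves newborns of weight `≥ p − d`; at
`d = p − 1` every legal edge qualifies, at `d < p − 1` only the states with `|r_k| ≥ 2(p − d)` do (at `(5,3)`: the `(2,1,1)`-states, not `(2,1)`).
[cite: CossartJannsenSaito2020, Lemma 12.1 (3), Lemma 12.2 (1), Lemma 13.6] [cite: CossartPiltant2008, Lemma 4.5 (2)] [cite: Hauser2010, §§F–G]
bears_on: LADDER-RESOLUTION:D157-DOOR2 (res-dim4-pi · K2(p) · slice C heavy line · p-generic LOSE step, chain dress).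
Supports stmt-ResolutionOfSingularities-16155 (helper).
-/

set_option linter.dupNamespace false -- mandated namespace of this single-conjunct summit

noncomputable section

namespace Summit.ResolutionOfSingularities.ResolutionOfSingularities.Theorems.PIDim4

namespace ResCone

open MvPolynomial Finset IsLocalRing
open Literature.AlgebraicGeometry.Resolution
open Literature.AlgebraicGeometry.Resolution.CentreBlowup
open Literature.AlgebraicGeometry.Resolution.Hauser2010
open Literature.AlgebraicGeometry.Resolution.HauserPerlega2019
open Literature.AlgebraicGeometry.Resolution.WeightedOrder
open PointBlowup (direction additiveSubspace)

variable {K : Type} [Field K]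

/-! ## 1. Transversality ⇒ hit pattern; the newborn weight on a tail -/

section Pattern

/-- **Transversal letter ⇒ hit pattern**: if the blow-up direction `direction j b = b.update j 1` has a non-zero `h`-component then either
`h` is the chart letter or `b h ≠ 0` (the letter `h` is translated, hence lost) — E_gen's binder `hdirW` gives L_gen's binder `hhit`.
Converse of res-dim4-p-7 g5's `heavyLine_direction_ne_zero`. [OURS · bookkeeping] [cite: HauserPerlega2019PRIMS, §2 (transform D' of D)] -/
theorem hit_of_direction_ne_zero {j h : Fin 4} {b : Fin 4 → K} (hdir : direction j b h ≠ 0) : j = h ∨ b h ≠ 0 := by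
  by_cases hjh : j = h
  · exact Or.inl hjh
  · right
    have hd : direction j b = Function.update b j 1 := rfl
    rwa [hd, Function.update_of_ne (Ne.symm hjh)] at hdir

variable {p : ℕ} [Fact p.Prime] [DecidableEq K]

/-- **The newborn weight on a constant-shade tail, any prime `p`, any shade `d`.**  Along a witnessed isolated above-floor `Step0 p` chain
with `x^{r₀} ∣ F₀` and constant shade `d` from `k₀`, for `k ≥ k₀` the newborn letter `j k` of `c (k+1)` weighs `|r_k| + d − p`
(boundary law of `tail_weights_laws`), and this weight is positive and `< p` (band `p < |r_k| + d < 2p`), hence NOT divisible by `p` —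
L_gen's binders `hr'` and `hndvd`. [OURS · bookkeeping] [cite: HauserPerlega2019PRIMS, §2 (transform D' of D)] -/
theorem tail_newborn_weight {c : ℕ → State K} {j : ℕ → Fin 4} {b : ℕ → Fin 4 → K}
    (hc : ∀ k, IsIsolated p (c k).F ∧ Step0 p (c k) (c (k + 1))) (hw : FreeTail.IsWitnessedChain p c j b)
    (hr0 : ∀ e ∈ (c 0).F.support, (c 0).r ≤ e) (hfloor : ∀ k, ordZero (c k).F ≠ p) {k₀ d : ℕ}
    (hshade : ∀ k, k₀ ≤ k → (c k).shade = ((d : ℕ) : ℕ∞)) {k : ℕ} (hk : k₀ ≤ k) :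
    (c (k + 1)).r (j k) = (c k).r.degree + d - p ∧ 0 < (c k).r.degree + d - p ∧ (c k).r.degree + d - p < p ∧
      ¬ p ∣ ((c k).r.degree + d - p) := by
  obtain ⟨-, hlaw, -, hband, -⟩ := tail_weights_laws hc hw hr0 hfloor hshade
  obtain ⟨hpo, ho2⟩ := hband k hk
  have hr' : (c (k + 1)).r (j k) = (c k).r.degree + d - p := by
    rw [hlaw k hk, Finsupp.coe_update, Function.update_self]
  refine ⟨hr', by omega, by omega, fun hdvd => ?_⟩
  have := Nat.le_of_dvd (by omega) hdvd
  omega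

end Pattern

/-! ## 2. The heavy LOSE step on a constant-shade tail (chain dress of `heavy_lose_step`) -/

section Lose

variable {p : ℕ} [Fact p.Prime] [CharP K p] [DecidableEq K]

/-- **THE HEAVY LOSE STEP ON A CONSTANT-SHADE TAIL, ANY PRIME `p`, ANY TAME SHADE `d < p`** (chain dress of L_gen `heavy_lose_step`).
Along a witnessed isolated above-floor `Step0 p` chain `c j b` with `x^{r₀} ∣ F₀`, constant shade `d < p` and `e_G ≡ 2` from `k₀`, let
`k ≥ k₀`, let `h` be a letter TRANSVERSAL to the step (`(direction (j k) (b k)) h ≠ 0`: `h` is the chart or is translated away), and let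
`n ≤ d` be a cleaning exponent with `(|r_k| + d − p) + n = p` (the newborn `j k`, of weight `|r_k| + d − p`, is supercritical for `n`).
Then an ENTRY frame at `k` — left-invertible `L` with `L u₁ = e_h`, y-rows annihilating `resVertex (c k)`, `μ = d` polygon of
`(G_k)`, `G_k = F_k / x^{r_k}`, with `pts ≠ ∅` and `d! < δs` — yields a RUN frame at `k+1`: `L′ u₁ = e_{j k}`, y′-rows annihilating
`resVertex (c (k+1))`, polygon of `(G_{k+1})` with `pts′ ≠ ∅`, `d! < δs′`, `d·αs′ ≤ (n − 1)·d!`, `0 < αs′`, and `βs′ ≤ βs`.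
Proof: `heavy_lose_step` with `hF hd hdiv hpo ho2` from `tail_factorisation` at `k`, `hF'` from `tail_step_factorisation`, `hF₁ hd₁`
from `tail_factorisation` at `k+1`, `hbj` / the step identity from the witnessing, `hr' hndvd` from `tail_newborn_weight`, `hhit` from
`hit_of_direction_ne_zero`, `hn1` from the band. [OURS]
[cite: CossartJannsenSaito2020, Lemma 12.1 (3), Lemma 12.2 (1), Lemma 13.6] [cite: CossartPiltant2008, Lemma 4.5 (2)] -/
theorem tail_heavy_lose_step {d n : ℕ} (hdp : d < p) (hnd : n ≤ d) {c : ℕ → State K} {j : ℕ → Fin 4} {b : ℕ → Fin 4 → K}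
    (hc : ∀ k, IsIsolated p (c k).F ∧ Step0 p (c k) (c (k + 1))) (hw : FreeTail.IsWitnessedChain p c j b)
    (hr0 : ∀ e ∈ (c 0).F.support, (c 0).r ≤ e) (hfloor : ∀ k, ordZero (c k).F ≠ p) {k₀ : ℕ}
    (hshade : ∀ k, k₀ ≤ k → (c k).shade = ((d : ℕ) : ℕ∞))
    (he : ∀ k, k₀ ≤ k → Module.finrank K (resVertex (c k)) = 2)
    {k : ℕ} (hk : k₀ ≤ k) (hn : (c k).r.degree + d - p + n = p) {h : Fin 4} (hdirh : direction (j k) (b k) h ≠ 0)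
    {L : Fin (2 + 2) → Fin 4 → K} {M : Fin 4 → Fin (2 + 2) → K} (hM : ∀ t u, ∑ i, M t i * L i u = if t = u then 1 else 0)
    (hLu1 : L (u1 2) = Pi.single h 1)
    (hy : ∀ i, i ≠ u1 2 → i ≠ u2 2 → ∀ w ∈ resVertex (c k), ∑ t, L i t * w t = 0)
    (hne : (pts (fun i => algebraMap (MvPolynomial (Fin 4) K) (OriginLocalization K 4) (∑ t, C (L i t) * X t))
      (Ideal.span {algebraMap (MvPolynomial (Fin 4) K) (OriginLocalization K 4) ((c k).F.divMonomial (c k).r)}) d).Nonempty)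
    (hδ : Nat.factorial d < deltaS (fun i => algebraMap (MvPolynomial (Fin 4) K) (OriginLocalization K 4) (∑ t, C (L i t) * X t))
      (Ideal.span {algebraMap (MvPolynomial (Fin 4) K) (OriginLocalization K 4) ((c k).F.divMonomial (c k).r)}) d) :
    ∃ (L' : Fin (2 + 2) → Fin 4 → K) (M' : Fin 4 → Fin (2 + 2) → K),
      ((∀ t u, ∑ i, M' t i * L' i u = if t = u then 1 else 0) ∧ L' (u1 2) = Pi.single (j k) 1 ∧
        (∀ i, i ≠ u1 2 → i ≠ u2 2 → ∀ w ∈ resVertex (c (k + 1)), ∑ t, L' i t * w t = 0) ∧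
        (pts (fun i => algebraMap (MvPolynomial (Fin 4) K) (OriginLocalization K 4) (∑ t, C (L' i t) * X t))
          (Ideal.span {algebraMap (MvPolynomial (Fin 4) K) (OriginLocalization K 4)
            ((c (k + 1)).F.divMonomial (c (k + 1)).r)}) d).Nonempty ∧
        Nat.factorial d < deltaS (fun i => algebraMap (MvPolynomial (Fin 4) K) (OriginLocalization K 4) (∑ t, C (L' i t) * X t))
          (Ideal.span {algebraMap (MvPolynomial (Fin 4) K) (OriginLocalization K 4)
            ((c (k + 1)).F.divMonomial (c (k + 1)).r)}) d ∧
        d * alphaS (fun i => algebraMap (MvPolynomial (Fin 4) K) (OriginLocalization K 4) (∑ t, C (L' i t) * X t))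
          (Ideal.span {algebraMap (MvPolynomial (Fin 4) K) (OriginLocalization K 4)
            ((c (k + 1)).F.divMonomial (c (k + 1)).r)}) d ≤ (n - 1) * Nat.factorial d) ∧
      0 < alphaS (fun i => algebraMap (MvPolynomial (Fin 4) K) (OriginLocalization K 4) (∑ t, C (L' i t) * X t))
          (Ideal.span {algebraMap (MvPolynomial (Fin 4) K) (OriginLocalization K 4)
            ((c (k + 1)).F.divMonomial (c (k + 1)).r)}) d ∧
      betaS (fun i => algebraMap (MvPolynomial (Fin 4) K) (OriginLocalization K 4) (∑ t, C (L' i t) * X t))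
          (Ideal.span {algebraMap (MvPolynomial (Fin 4) K) (OriginLocalization K 4)
            ((c (k + 1)).F.divMonomial (c (k + 1)).r)}) d ≤
        betaS (fun i => algebraMap (MvPolynomial (Fin 4) K) (OriginLocalization K 4) (∑ t, C (L i t) * X t))
          (Ideal.span {algebraMap (MvPolynomial (Fin 4) K) (OriginLocalization K 4) ((c k).F.divMonomial (c k).r)}) d := by
  have hk1 : k₀ ≤ k + 1 := by omega
  obtain ⟨hF, hd, hpo, ho2, hdiv⟩ := tail_factorisation hc hr0 hfloor hshade hk
  obtain ⟨hF', -⟩ := tail_step_factorisation hc hw hr0 hfloor hshade hk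
  obtain ⟨hF₁, hd₁, -, -, -⟩ := tail_factorisation hc hr0 hfloor hshade hk1
  obtain ⟨hr', -, -, hndvd⟩ := tail_newborn_weight hc hw hr0 hfloor hshade hk
  have hbj : b k (j k) = 0 := (hw k).2.1
  have hck1 : c (k + 1) = CentreBlowup.step p Finset.univ (j k) (b k) (c k) := (hw k).2.2.2.2
  have hshade_eq : (CentreBlowup.step p Finset.univ (j k) (b k) (c k)).shade = (c k).shade := by
    rw [← hck1, hshade (k + 1) hk1, hshade k hk]
  exact heavy_lose_step (p := p) (d := d) (n := n) hdp (by omega) hnd hn hpo ho2 hndvd hF hd hdiv hbj hF' hF₁ hd₁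
    (hc (k + 1)).1 hshade_eq (he k hk) (he (k + 1) hk1) (hit_of_direction_ne_zero hdirh) hr' hM hLu1 hy hne hδ

/-! ## 3. The same, with the newborn's letter bookkeeping appended -/

/-- **THE HEAVY LOSE STEP ON A TAIL, WITH THE NEWBORN'S WEIGHT** — `tail_heavy_lose_step` together with `r_{k+1} (j k) = |r_k| + d − p`
and `r_{k+1} (j k) + n = p`: the RUN frame's letter `j k` is exactly supercritical for the same exponent `n`, which is E_gen's /
L_gen's supercriticality input `p ≤ r_{k+1} (j k) + n` at the next edge (in p-7 g5's `(p, p−1)` RunInv this is the conjunct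
`(c k).r h = 2`). [OURS] [cite: CossartJannsenSaito2020, Lemma 12.1 (3), Lemma 13.6] [cite: CossartPiltant2008, Lemma 4.5 (2)] -/
theorem tail_heavy_lose_step_newborn {d n : ℕ} (hdp : d < p) (hnd : n ≤ d) {c : ℕ → State K} {j : ℕ → Fin 4}
    {b : ℕ → Fin 4 → K}
    (hc : ∀ k, IsIsolated p (c k).F ∧ Step0 p (c k) (c (k + 1))) (hw : FreeTail.IsWitnessedChain p c j b)
    (hr0 : ∀ e ∈ (c 0).F.support, (c 0).r ≤ e) (hfloor : ∀ k, ordZero (c k).F ≠ p) {k₀ : ℕ}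
    (hshade : ∀ k, k₀ ≤ k → (c k).shade = ((d : ℕ) : ℕ∞))
    (he : ∀ k, k₀ ≤ k → Module.finrank K (resVertex (c k)) = 2)
    {k : ℕ} (hk : k₀ ≤ k) (hn : (c k).r.degree + d - p + n = p) {h : Fin 4} (hdirh : direction (j k) (b k) h ≠ 0)
    {L : Fin (2 + 2) → Fin 4 → K} {M : Fin 4 → Fin (2 + 2) → K} (hM : ∀ t u, ∑ i, M t i * L i u = if t = u then 1 else 0)
    (hLu1 : L (u1 2) = Pi.single h 1)
    (hy : ∀ i, i ≠ u1 2 → i ≠ u2 2 → ∀ w ∈ resVertex (c k), ∑ t, L i t * w t = 0)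
    (hne : (pts (fun i => algebraMap (MvPolynomial (Fin 4) K) (OriginLocalization K 4) (∑ t, C (L i t) * X t))
      (Ideal.span {algebraMap (MvPolynomial (Fin 4) K) (OriginLocalization K 4) ((c k).F.divMonomial (c k).r)}) d).Nonempty)
    (hδ : Nat.factorial d < deltaS (fun i => algebraMap (MvPolynomial (Fin 4) K) (OriginLocalization K 4) (∑ t, C (L i t) * X t))
      (Ideal.span {algebraMap (MvPolynomial (Fin 4) K) (OriginLocalization K 4) ((c k).F.divMonomial (c k).r)}) d) :
    ∃ (L' : Fin (2 + 2) → Fin 4 → K) (M' : Fin 4 → Fin (2 + 2) → K),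
      ((∀ t u, ∑ i, M' t i * L' i u = if t = u then 1 else 0) ∧ L' (u1 2) = Pi.single (j k) 1 ∧
        (∀ i, i ≠ u1 2 → i ≠ u2 2 → ∀ w ∈ resVertex (c (k + 1)), ∑ t, L' i t * w t = 0) ∧
        ((c (k + 1)).r (j k) = (c k).r.degree + d - p ∧ (c (k + 1)).r (j k) + n = p) ∧
        (pts (fun i => algebraMap (MvPolynomial (Fin 4) K) (OriginLocalization K 4) (∑ t, C (L' i t) * X t))
          (Ideal.span {algebraMap (MvPolynomial (Fin 4) K) (OriginLocalization K 4)
            ((c (k + 1)).F.divMonomial (c (k + 1)).r)}) d).Nonempty ∧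
        Nat.factorial d < deltaS (fun i => algebraMap (MvPolynomial (Fin 4) K) (OriginLocalization K 4) (∑ t, C (L' i t) * X t))
          (Ideal.span {algebraMap (MvPolynomial (Fin 4) K) (OriginLocalization K 4)
            ((c (k + 1)).F.divMonomial (c (k + 1)).r)}) d ∧
        d * alphaS (fun i => algebraMap (MvPolynomial (Fin 4) K) (OriginLocalization K 4) (∑ t, C (L' i t) * X t))
          (Ideal.span {algebraMap (MvPolynomial (Fin 4) K) (OriginLocalization K 4)
            ((c (k + 1)).F.divMonomial (c (k + 1)).r)}) d ≤ (n - 1) * Nat.factorial d) ∧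
      0 < alphaS (fun i => algebraMap (MvPolynomial (Fin 4) K) (OriginLocalization K 4) (∑ t, C (L' i t) * X t))
          (Ideal.span {algebraMap (MvPolynomial (Fin 4) K) (OriginLocalization K 4)
            ((c (k + 1)).F.divMonomial (c (k + 1)).r)}) d ∧
      betaS (fun i => algebraMap (MvPolynomial (Fin 4) K) (OriginLocalization K 4) (∑ t, C (L' i t) * X t))
          (Ideal.span {algebraMap (MvPolynomial (Fin 4) K) (OriginLocalization K 4)
            ((c (k + 1)).F.divMonomial (c (k + 1)).r)}) d ≤
        betaS (fun i => algebraMap (MvPolynomial (Fin 4) K) (OriginLocalization K 4) (∑ t, C (L i t) * X t))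
          (Ideal.span {algebraMap (MvPolynomial (Fin 4) K) (OriginLocalization K 4) ((c k).F.divMonomial (c k).r)}) d := by
  obtain ⟨hr', -, -, -⟩ := tail_newborn_weight hc hw hr0 hfloor hshade hk
  obtain ⟨L', M', ⟨hM', hL'u1, hy', hne', hδ', hα'⟩, hpos, hle⟩ :=
    tail_heavy_lose_step hdp hnd hc hw hr0 hfloor hshade he hk hn hdirh hM hLu1 hy hne hδ
  exact ⟨L', M', ⟨hM', hL'u1, hy', ⟨hr', by rw [hr']; exact hn⟩, hne', hδ', hα'⟩, hpos, hle⟩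

end Lose

end ResCone

end Summit.ResolutionOfSingularities.ResolutionOfSingularities.Theorems.PIDim4

end
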